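import Summits.ResolutionOfSingularities.ResolutionOfSingularities.Theorems.FrobeniusClosingPatchingRelPerfectCoreRungLinearCentre
import HarnessLib

/-!
# Crux `PatchingRelPerfect` (stmt-ResolutionOfSingularities-16161), chain w52 — CORE RUNG r1b⁺:
# powers of the linear centre (`I · 𝔪ᴺ = Pᵇ · 𝔪ᴹ`, `b, M ≥ 1`)

[OURS · L1 W5.2 · rung] Rung r1b (`CoreRungLinearCentre`) proved that `Bl_{P·𝔪ᴹ} Spec S` is
regular for `S` regular local and `P` part of a regular system of parameters, and deduced the
blow-up-form open core `AtomDimFourBlowupAt` (companion form) on `{I : I · 𝔪ᴺ = P · 𝔪ᴹ}`.  Since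
the regular scheme `Bl_{ℙʳ_κ}(Bl_P Spec S)` is ALSO a blowing up along `(Pᵇ · 𝔪ᴹ)~` for every
`b ≥ 1` (the exceptional ideal `P 𝒪` is an effective Cartier divisor upstairs and stays one under
the second blowing up, Stacks 080A with `IsBlowup.id`), the family extends to
`{I : I · 𝔪ᴺ = Pᵇ · 𝔪ᴹ, b ≥ 1, M ≥ 1}` ⊇ the sandwiches `(u₁ᵃ, …, u_nᵃ) · Pᵇ ⊆ I ⊆ 𝔪ᵃ · Pᵇ`
(e.g. `n = 4`, `P = (u₁, u₂, u₃)`, `a = b = 2`).  Every dimension, every regular local base;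
BC5-type evidence for the core.  Nothing here is a statement of the manuscript under review.

Results: `isBlowup_comp_span_pow_mul_pow_maximalIdeal`,
`isRegular_of_isBlowup_span_pow_mul_pow_maximalIdeal`, `isRegular_of_isBlowup_rsopPart_pow_mul_pow`,
`coreRung_of_mul_pow_eq_rsopPart_pow_mul_pow`, `coreRung_of_sandwich_rsopPart_pow`.

## References

* Q. Liu, *Algebraic Geometry and Arithmetic Curves*, OUP 2002, Thm. 8.1.19 (a), (b). [Liu2002]
* The Stacks Project, Tag 080A. [StacksProject]
-/

-- `Summit.<Summit>.<Sub>.Theorems` with `Sub = Summit` (single-conjunct summit, D-0017)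
set_option linter.dupNamespace false

noncomputable section

open CategoryTheory CategoryTheory.Limits AlgebraicGeometry Literature.AlgebraicGeometry.Resolution

namespace Summit.ResolutionOfSingularities.ResolutionOfSingularities.Theorems

universe u

/-- **`Bl_P` followed by the blowing up of the closed fibre is a blowing up along `(Pᵇ · 𝔪ᴹ)~`
for all `b, M ≥ 1`** (`P 𝒪` is an effective Cartier divisor upstairs; Stacks 080A with the
identity as the blowing up of a Cartier divisor). [cite: StacksProject, Tag 080A] -/
theorem isBlowup_comp_span_pow_mul_pow_maximalIdeal {S : Type u} [CommRing S] [IsLocalRing S]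
    (P : Ideal S) {X' X'' : Scheme.{u}} {π : X' ⟶ Spec (.of S)}
    (hπ : IsBlowup π (affineBlowup.idealSheaf P)) {π' : X'' ⟶ X'}
    (hπ' : IsBlowup π' ((affineBlowup.idealSheaf (IsLocalRing.maximalIdeal S)).comap π))
    (b : ℕ) (hb : 0 < b) (M : ℕ) (hM : 0 < M) :
    IsBlowup (π' ≫ π) (affineBlowup.idealSheaf (P ^ b * IsLocalRing.maximalIdeal S ^ M)) := by
  induction b with
  | zero => exact absurd hb (lt_irrefl 0)
  | succ b ih =>
    rcases Nat.eq_zero_or_pos b with h0 | hpos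
    · subst h0
      rw [zero_add, pow_one]
      exact isBlowup_comp_span_mul_pow_maximalIdeal P hπ hπ' M hM
    · have h1 := ih hpos
      have hE : IsEffectiveCartier ((affineBlowup.idealSheaf P).comap (π' ≫ π)) := by
        rw [Scheme.IdealSheafData.comap_comp]
        exact hπ.isEffectiveCartier.comap_of_isBlowup hπ'
      have h2 := h1.comp (IsBlowup.id hE)
      rw [Category.id_comp, ← affineBlowup.idealSheaf_mul, mul_right_comm, ← pow_succ] at h2
      exact h2

/-- **`Bl_{Pᵇ·𝔪ᴹ} Spec S` is regular** (`S` regular local, `P = (x₀, …, x_r) ⊆ 𝔪` quasi-regular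
with `S/P` regular, `b, M ≥ 1`): it is isomorphic to the regular `Bl_{ℙʳ_κ}(Bl_P Spec S)` of rung
r1b. [cite: Liu2002, Thm. 8.1.19 (a), (b)] [cite: StacksProject, Tag 080A] -/
theorem isRegular_of_isBlowup_span_pow_mul_pow_maximalIdeal {S : Type u} [CommRing S]
    [IsRegularLocalRing S] {r : ℕ} (x : Fin (r + 1) → S) (hx : IsQuasiRegular x)
    [IsRegularRing (S ⧸ Ideal.span (Set.range x))]
    (hP : Ideal.span (Set.range x) ≤ IsLocalRing.maximalIdeal S) (b : ℕ) (hb : 0 < b) (M : ℕ)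
    (hM : 0 < M) {B : Scheme.{u}} {β : B ⟶ Spec (.of S)}
    (hβ : IsBlowup β (affineBlowup.idealSheaf
      (Ideal.span (Set.range x) ^ b * IsLocalRing.maximalIdeal S ^ M))) :
    Scheme.IsRegular B := by
  -- the regular model: `Bl_P` followed by the blowing up of its closed fibre
  have hB0 := affineBlowup.isBlowup (Ideal.span (Set.range x))
  obtain ⟨X'', π', hπ'⟩ := exists_isBlowup (affineBlowup (Ideal.span (Set.range x)))
    ((affineBlowup.idealSheaf (IsLocalRing.maximalIdeal S)).comap
      (affineBlowup.π (Ideal.span (Set.range x))))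
  -- it is regular: it is a blowing up along `(P · 𝔪)~`
  have hreg : Scheme.IsRegular X'' :=
    isRegular_of_isBlowup_span_mul_pow_maximalIdeal x hx hP 1 one_pos
      (isBlowup_comp_span_mul_pow_maximalIdeal (Ideal.span (Set.range x)) hB0 hπ' 1 one_pos)
  -- and it is a blowing up along `(Pᵇ · 𝔪ᴹ)~`
  have hcomp := isBlowup_comp_span_pow_mul_pow_maximalIdeal (Ideal.span (Set.range x)) hB0 hπ'
    b hb M hM
  obtain ⟨e, -, -⟩ := hβ.unique hcomp
  exact SectionAscent.TraceIdeal.isRegular_of_iso e hreg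

/-- **`Bl_{Pᵇ·𝔪ᴹ} Spec S` is regular for `P` part of a regular system of parameters**
(`b, M ≥ 1`). [cite: Liu2002, Thm. 8.1.19 (a), (b)] [cite: Matsumura1987, Thm. 16.2] -/
theorem isRegular_of_isBlowup_rsopPart_pow_mul_pow {S : Type u} [CommRing S]
    [IsRegularLocalRing S] {r : ℕ} {x : Fin (r + 1) → S} (hz : IsRsopPart x) (b : ℕ) (hb : 0 < b)
    (M : ℕ) (hM : 0 < M) {B : Scheme.{u}} {β : B ⟶ Spec (.of S)}
    (hβ : IsBlowup β (affineBlowup.idealSheaf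
      (Ideal.span (Set.range x) ^ b * IsLocalRing.maximalIdeal S ^ M))) :
    Scheme.IsRegular B := by
  haveI : IsRegularRing (S ⧸ Ideal.span (Set.range x)) := by
    haveI := hz.isRegularLocalRing_quotient
    exact isRegularRing_of_isRegularLocalRing _
  exact isRegular_of_isBlowup_span_pow_mul_pow_maximalIdeal x hz.isQuasiRegular
    hz.span_range_le_maximalIdeal b hb M hM hβ

/-- **CORE RUNG r1b⁺, equation form**: `S` regular local, `P` part of a regular system of
parameters, `I ≠ 0` with `I · 𝔪ᴺ = Pᵇ · 𝔪ᴹ` (`b, M ≥ 1`) ⇒ every blowing up `T = Bl_I Spec S`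
satisfies the conclusion of the blow-up-form open core (companion `𝔪ᴺ`).
[cite: Liu2002, Thm. 8.1.19 (a), (b)] [cite: StacksProject, Tag 080A] -/
theorem coreRung_of_mul_pow_eq_rsopPart_pow_mul_pow {S : Type u} [CommRing S]
    [IsRegularLocalRing S] {r : ℕ} {x : Fin (r + 1) → S} (hz : IsRsopPart x) {I : Ideal S}
    {N b M : ℕ} (hb : 0 < b) (hM : 0 < M)
    (hIN : I * IsLocalRing.maximalIdeal S ^ N =
      Ideal.span (Set.range x) ^ b * IsLocalRing.maximalIdeal S ^ M)
    (hI : I ≠ ⊥) (T : Scheme.{u}) (f : T ⟶ Spec (.of S))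
    (hf : IsBlowup f (affineBlowup.idealSheaf I)) :
    ∃ (J : T.IdealSheafData) (T' : Scheme.{u}) (π : T' ⟶ T), J ≠ ⊥ ∧
      (∀ t : T, t ∈ J.support → f.base t = IsLocalRing.closedPoint S) ∧
      IsBlowup π J ∧ Scheme.IsRegular T' := by
  by_cases hm : IsLocalRing.maximalIdeal S = ⊥
  · exact coreRung_of_maximalIdeal_eq_bot hm hI T f hf
  · haveI : IsDomain S := isDomain_of_isRegularLocalRing S
    have hQ : IsLocalRing.maximalIdeal S ^ N ≠ ⊥ := by
      rw [Ne, ← Submodule.zero_eq_bot]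
      exact pow_ne_zero _ (fun h => hm (h.trans Submodule.zero_eq_bot))
    exact atomConclusion_of_mul_eq_of_forall_isRegular hIN hI hQ le_rfl
      (fun B β hβ => isRegular_of_isBlowup_rsopPart_pow_mul_pow hz b hb M hM hβ) T f hf

/-- **CORE RUNG r1b⁺ on sandwiches `(u₁ᵃ, …, u_nᵃ) · Pᵇ ⊆ I ⊆ 𝔪ᵃ · Pᵇ`** (`b ≥ 1`, `P` part
of a regular system of parameters, `I ≠ 0`): companion `𝔪^{n(a-1)+1}`.
[cite: Liu2002, Thm. 8.1.19 (a), (b)] [cite: StacksProject, Tag 080A] -/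
theorem coreRung_of_sandwich_rsopPart_pow {S : Type u} [CommRing S] [IsRegularLocalRing S]
    {n : ℕ} (u : Fin n → S) (hu : Ideal.span (Set.range u) = IsLocalRing.maximalIdeal S)
    {r : ℕ} {x : Fin (r + 1) → S} (hz : IsRsopPart x) (b : ℕ) (hb : 0 < b) {I : Ideal S}
    {a : ℕ} (hle : I ≤ IsLocalRing.maximalIdeal S ^ a * Ideal.span (Set.range x) ^ b)
    (hge : Ideal.span (Set.range fun j => u j ^ a) * Ideal.span (Set.range x) ^ b ≤ I)
    (hI : I ≠ ⊥) (T : Scheme.{u}) (f : T ⟶ Spec (.of S))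
    (hf : IsBlowup f (affineBlowup.idealSheaf I)) :
    ∃ (J : T.IdealSheafData) (T' : Scheme.{u}) (π : T' ⟶ T), J ≠ ⊥ ∧
      (∀ t : T, t ∈ J.support → f.base t = IsLocalRing.closedPoint S) ∧
      IsBlowup π J ∧ Scheme.IsRegular T' :=
  coreRung_of_mul_pow_eq_rsopPart_pow_mul_pow hz (N := n * (a - 1) + 1)
    (M := a + (n * (a - 1) + 1)) hb (by omega)
    (CoreRung.mul_pow_eq_mul_pow_of_sandwich u hu (by omega) hle hge) hI T f hf

end Summit.ResolutionOfSingularities.ResolutionOfSingularities.Theorems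

end
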